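import Summits.ABC.StewartYu.ArchG3RecLinesHF
import Summits.ABC.StewartYu.ArchG3RecLinesA
import HarnessLib

/-!
# The archimedean record `ArchG3Rec` — letter lines in closed form, H family (half step): ATOMS OF THE (J) AND (C) LINES

Support file (theorems only; no named facts). Cell `abc-stewartyu`, route `YuMatveevShapeRat`, crux r2 `ArchCoreRat` (stmt-ABC-20502),
line `arch-g3-frame`, seam (B) of `stub_recLinesArch`, plan R50: the jets line (J), the comparison line (C) and the smallness letter of
`HalfStepLinesK (2^(n−1)) c lev` — all three are killed by the comparison constant `U0 c = cⁿ·Ω·W ≥ 2^{3n}·Z ≥ 128·(nB + B)` (p4's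
`U0_ge`, `c ≥ 2^63`) — and the assembled family **`halfStepLinesK_holds`** (side conditions = p1's `side_half`; (F) = `halfF_holds`).
* `U0_big`, `cbRK_le` (`cbRK ≤ XL/2^16 − U0`), `log_two_radius_le`, `logJ_le` (the interpolation logarithm `≤ (336/5)·B + 19·XL`),
  `TlogCRK_le` (`T·log(2·CRK) ≤ 8·XL`, sorted weights), `jet_le` (the `2ⁿ`-threshold bracket, any `σ`);
(The lines themselves and the assembled family `halfStepLinesK_holds` are in `ArchG3RecLinesHJC`.)

## References
* [Nesterenko2003] Yu. V. Nesterenko, LNM 1819 (2003) — §4 Prop. 4.1, §4.3 (4.36)–(4.51); shape only.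
-/

noncomputable section

open Finset Real
open scoped Nat
open Summit.ABC.StewartYu.ArchSupply (WC)
open Summit.ABC.StewartYu.ArchG3Setup (DΔC)

namespace Summit.ABC.StewartYu

namespace ArchG3Rec

open PadicG3Par (Cb Cb_pos)
open ArchG3Par (G K yloadK G_eq G_pos K_pos yloadK_pos eight_le_G one_le_K)

variable {n : ℕ} (P : ArchG3Rec n)

/-! ### The comparison constant -/

/-- **the comparison constant dominates**: for `c ≥ 2^63`, `16·2ⁿ·Z ≤ U0 c` and `X·L/2^16 ≤ U0 c` (p4's `U0_ge 3`: `2^{3n}Z ≤ U0 c`).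
[cite: Nesterenko2003, §4.3 (4.50); shape only] -/
theorem U0_big (hn2 : 2 ≤ n) {c : ℝ} (hc : (2 : ℝ) ^ 63 ≤ c) :
    16 * (2 ^ n * P.Z) ≤ P.U0 c ∧ (P.X : ℝ) * P.L / 2 ^ 16 ≤ P.U0 c := by
  have hU0 := P.U0_ge 3 hc
  obtain ⟨-, -, hG, hL0, -, -, -⟩ := P.letters_real 0
  have hZ : P.Z = 8 * ((n : ℝ) + 1) * ((P.X : ℝ) * P.L) := by unfold Z; rw [hG]
  have hZ0 := P.Z_floors.1
  have hn0 : (0 : ℝ) ≤ n := Nat.cast_nonneg n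
  have hpow : (2 : ℝ) ^ (3 * n) = 2 ^ n * (2 ^ n) ^ 2 := by rw [← pow_mul, ← pow_add]; ring_nf
  have h2n : (4 : ℝ) ≤ 2 ^ n :=
    calc (4 : ℝ) = 2 ^ 2 := by norm_num
      _ ≤ 2 ^ n := pow_le_pow_right₀ (by norm_num) hn2
  have h16 : 16 * (2 : ℝ) ^ n ≤ 2 ^ (3 * n) := by rw [hpow]; nlinarith
  have h1 : 16 * (2 ^ n * P.Z) ≤ 2 ^ (3 * n) * P.Z := by nlinarith
  refine ⟨h1.trans hU0, ?_⟩
  have h2 : (P.X : ℝ) * P.L / 2 ^ 16 ≤ P.Z := by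
    rw [hZ, div_le_iff₀ (by norm_num)]; nlinarith [mul_nonneg hn0 (by positivity : (0 : ℝ) ≤ (P.X : ℝ) * P.L)]
  nlinarith

/-- the comparison letter in closed form is killed: `cbRK (2^(n−1)) c lev m ≤ X·L/2^16 − U0 c` whenever `m + 1 ≤ 2^lev·2^{n+6}·e^G·X`.
[cite: Nesterenko2003, §4.3 (4.50); shape only] -/
theorem cbRK_le (hn2 : 2 ≤ n) {lev : ℕ} (hlev : lev ≤ P.Sd) (c : ℝ) (m : ℕ)
    (hm : (m : ℝ) + 1 ≤ 2 ^ lev * (2 : ℝ) ^ (n + 6) * Real.exp (G n) * P.X) :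
    P.cbRK (2 ^ (n - 1)) c lev m ≤ (P.X : ℝ) * P.L / 2 ^ 16 - P.U0 c := by
  have h := P.cb_logs_le hn2 hlev (Nat.cast_nonneg m) (by linarith)
  unfold cbRK
  linarith

/-! ### The interpolation logarithm and the jets constant -/

/-- the node radius in logarithm: `log(2·(2^lev·2^{n+6}·e^G·X)) ≤ 2X` for `lev ≤ Ŝ` (`Ŝ log 2 ≤ 10n + 29 + log N`, `log N ≤ X/8`,
`n + 1 ≤ X/64`). [folklore] -/
theorem log_two_radius_le (hn2 : 2 ≤ n) {lev : ℕ} (hlev : lev ≤ P.Sd) :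
    Real.log (2 * (2 ^ lev * (2 : ℝ) ^ (n + 6) * Real.exp (G n) * P.X)) ≤ 2 * P.X ∧
    (1 : ℝ) ≤ 2 ^ lev * (2 : ℝ) ^ (n + 6) * Real.exp (G n) * P.X := by
  obtain ⟨-, hSd⟩ := P.Sd_log_le
  have hX : (64 : ℝ) * (n + 1) ≤ P.X := by exact_mod_cast P.X_floors.1
  have hX8 := P.eight_WN_le_X
  have hWN := P.WN_bounds
  obtain ⟨-, hlogX, -, -, -⟩ := P.log_letters_le
  have hn : (2 : ℝ) ≤ n := by exact_mod_cast hn2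
  have hX0 : (0 : ℝ) < P.X := by linarith
  have hl2 := Real.log_two_lt_d9
  have hl2p : 0 < Real.log 2 := Real.log_pos one_lt_two
  have hG : G n = 8 * (n + 1) := G_eq n
  have hG1 : (1 : ℝ) ≤ Real.exp (G n) := Real.one_le_exp (G_pos n).le
  have h2l : (1 : ℝ) ≤ 2 ^ lev := one_le_pow₀ (by norm_num)
  have h26 : (1 : ℝ) ≤ 2 ^ (n + 6) := one_le_pow₀ (by norm_num)
  have hB1 : (1 : ℝ) ≤ 2 ^ lev * (2 : ℝ) ^ (n + 6) * Real.exp (G n) * P.X :=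
    one_le_mul_of_one_le_of_one_le (one_le_mul_of_one_le_of_one_le (one_le_mul_of_one_le_of_one_le h2l h26) hG1) (by linarith)
  refine ⟨?_, hB1⟩
  have e2 : Real.log (2 * (2 ^ lev * (2 : ℝ) ^ (n + 6) * Real.exp (G n) * P.X)) =
      Real.log 2 + (lev * Real.log 2 + (n + 6) * Real.log 2 + G n + Real.log P.X) := by
    have hne1 : (2 : ℝ) ^ lev * 2 ^ (n + 6) ≠ 0 := by positivity
    have hne2 : (2 : ℝ) ^ lev * 2 ^ (n + 6) * Real.exp (G n) ≠ 0 := by positivity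
    rw [Real.log_mul two_ne_zero (by positivity), Real.log_mul hne2 hX0.ne', Real.log_mul hne1 (Real.exp_pos _).ne',
      Real.log_mul (by positivity) (by positivity), Real.log_pow, Real.log_pow, Real.log_exp]; push_cast; ring
  rw [e2, hG]
  have h5 : (lev : ℝ) * Real.log 2 ≤ 10 * n + 29 + Real.log P.N := by
    have h' : (lev : ℝ) ≤ P.Sd := by exact_mod_cast hlev
    have := mul_le_mul_of_nonneg_right h' hl2p.le
    linarith
  have h8 : ((n : ℝ) + 7) * Real.log 2 ≤ (n + 7) := by
    have := mul_le_mul_of_nonneg_left (hl2.le.trans (by norm_num : (0.6931471808 : ℝ) ≤ 1)) (by linarith : (0 : ℝ) ≤ n + 7)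
    linarith
  nlinarith

/-- **the interpolation logarithm of the jets line**:
`log(2·(2Nf+1)^{T+1}·T·(20e)^{(2Nf+1)T}) ≤ (336/5)·2ⁿ·X·L + 19·X·L` (`(2Nf+1)T ≤ 2^{n+4}XL`, `log(20e) ≤ 21/5`,
`log(2Nf+1) ≤ 2X`, `T + 1 ≤ 9L`). [cite: Nesterenko2003, §4.3 (4.41); shape only] -/
theorem logJ_le (hn2 : 2 ≤ n) {lev : ℕ} (hlev : lev ≤ P.Sd) :
    Real.log (2 * ((2 * P.Nf lev n + 1 : ℕ) : ℝ) ^ (P.T lev + 1) * P.T lev * (20 * Real.exp 1) ^ ((2 * P.Nf lev n + 1) * P.T lev)) ≤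
      336 / 5 * (2 ^ n * ((P.X : ℝ) * P.L)) + 19 * ((P.X : ℝ) * P.L) := by
  obtain ⟨hlogR, hR1⟩ := P.log_two_radius_le hn2 hlev
  obtain ⟨-, -, hρNf, -, hNf0, -⟩ := P.rho_bounds lev
  obtain ⟨-, -, hNf1⟩ := P.rho_succ_bounds lev
  have hz := P.zeros_le lev
  obtain ⟨-, -, -, hl20⟩ := log_consts
  obtain ⟨-, -, -, hL0, -, hT1, hT8⟩ := P.letters_real lev
  have hX : (128 : ℝ) ≤ P.X := P.X_floors.2.1
  have hL1 : (1 : ℝ) ≤ P.L := P.L_real.1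
  have hl2 := Real.log_two_lt_d9
  set R : ℝ := 2 ^ lev * (2 : ℝ) ^ (n + 6) * Real.exp (G n) * P.X with hR
  -- the node count as a real
  have hM : ((2 * P.Nf lev n + 1 : ℕ) : ℝ) = 2 * (P.Nf lev n : ℝ) + 1 := by push_cast; ring
  have hM1 : (1 : ℝ) ≤ ((2 * P.Nf lev n + 1 : ℕ) : ℝ) := by rw [hM]; linarith
  have hM0 : (0 : ℝ) < ((2 * P.Nf lev n + 1 : ℕ) : ℝ) := by linarith
  have hMR : ((2 * P.Nf lev n + 1 : ℕ) : ℝ) ≤ 2 * R := by rw [hM]; linarith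
  have hT0 : (0 : ℝ) < P.T lev := by linarith
  have h20 : (0 : ℝ) < 20 * Real.exp 1 := by positivity
  -- split the logarithm
  have e : Real.log (2 * ((2 * P.Nf lev n + 1 : ℕ) : ℝ) ^ (P.T lev + 1) * P.T lev * (20 * Real.exp 1) ^ ((2 * P.Nf lev n + 1) * P.T lev)) =
      Real.log 2 + (((P.T lev + 1 : ℕ)) : ℝ) * Real.log ((2 * P.Nf lev n + 1 : ℕ) : ℝ) + Real.log (P.T lev) +
        ((((2 * P.Nf lev n + 1) * P.T lev : ℕ)) : ℝ) * Real.log (20 * Real.exp 1) := by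
    rw [Real.log_mul (by positivity) (by positivity), Real.log_mul (by positivity) hT0.ne',
      Real.log_mul two_ne_zero (by positivity), Real.log_pow, Real.log_pow]
  rw [e]
  have hlogM : Real.log ((2 * P.Nf lev n + 1 : ℕ) : ℝ) ≤ 2 * P.X :=
    (Real.log_le_log hM0 hMR).trans hlogR
  have hlogM0 : 0 ≤ Real.log ((2 * P.Nf lev n + 1 : ℕ) : ℝ) := Real.log_nonneg hM1
  have hT9 : (((P.T lev + 1 : ℕ)) : ℝ) ≤ 9 * P.L := by push_cast; linarith
  have h1 : (((P.T lev + 1 : ℕ)) : ℝ) * Real.log ((2 * P.Nf lev n + 1 : ℕ) : ℝ) ≤ 9 * P.L * (2 * P.X) :=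
    mul_le_mul hT9 hlogM hlogM0 (by positivity)
  have h2 : Real.log (P.T lev : ℝ) ≤ 8 * P.L := by have := Real.log_le_sub_one_of_pos hT0; linarith
  have h3 : ((((2 * P.Nf lev n + 1) * P.T lev : ℕ)) : ℝ) * Real.log (20 * Real.exp 1) ≤ 2 ^ (n + 4) * ((P.X : ℝ) * P.L) * (21 / 5) :=
    mul_le_mul hz hl20 (Real.log_nonneg (by have := Real.add_one_le_exp (1 : ℝ); linarith)) (by positivity)
  have hpow : (2 : ℝ) ^ (n + 4) = 2 ^ n * 16 := by rw [pow_add]; norm_num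
  rw [hpow] at h3
  have h4 : (8 : ℝ) * P.L + 1 ≤ (P.X : ℝ) * P.L / 8 := by rw [le_div_iff₀ (by norm_num)]; nlinarith
  nlinarith

/-- **the jets constant of the half step (sorted weights)**: `T lev·log(2·CRK (2^(n−1)) lev) ≤ 8·X·L`
(`log(2·CRK) ≤ log 2 + log(1 + (7/2)n²(2^{n−1}n)·Bexp·N²·2^lev)`, `Bexp = e^{W−1}`, `T ≤ 8L`, `L·WN ≤ X·L/8`).
[cite: Nesterenko2003, §4.2 Lemma 4.3; shape only] -/
theorem TlogCRK_le (hn2 : 2 ≤ n) (hmono : Monotone P.A) {lev : ℕ} (hlev : lev ≤ P.Sd) :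
    (P.T lev : ℝ) * Real.log (2 * P.CRK (2 ^ (n - 1)) lev) ≤ 8 * ((P.X : ℝ) * P.L) := by
  have hκ : 1 ≤ 2 ^ (n - 1) := Nat.one_le_two_pow
  obtain ⟨hC1, hC⟩ := P.log_CRK_le (2 ^ (n - 1)) hκ hmono lev
  obtain ⟨hlogκ, hlogκ0⟩ := log_kappa_le P.hn
  obtain ⟨-, -, hf1⟩ := ArchG3Rec.kappa_pred_le (κ := 2 ^ (n - 1)) (n := n) hκ P.hn
  obtain ⟨-, hSd⟩ := P.Sd_log_le
  obtain ⟨hZ0, hZW, -, -⟩ := P.Z_floors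
  obtain ⟨-, -, hG, hL0, -, hT1, hT8⟩ := P.letters_real lev
  have hX : (64 : ℝ) * (n + 1) ≤ P.X := by exact_mod_cast P.X_floors.1
  have hX128 : (128 : ℝ) ≤ P.X := P.X_floors.2.1
  have hX8 := P.eight_WN_le_X
  have hWN := P.WN_bounds
  have hN := P.N_facts
  have hB1 : 1 ≤ P.Bexp := P.Alast_facts.2.2.2.2.2
  have hBlog : Real.log P.Bexp = P.W - 1 := by unfold Bexp; rw [Real.log_exp]
  have hn : (2 : ℝ) ≤ n := by exact_mod_cast hn2
  have hn0 : (0 : ℝ) < n := by linarith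
  have hl2 := Real.log_two_lt_d9
  have hl2p : 0 < Real.log 2 := Real.log_pos one_lt_two
  have h2l : (1 : ℝ) ≤ 2 ^ lev := one_le_pow₀ (by norm_num)
  have hZ : P.Z = 8 * ((n : ℝ) + 1) * ((P.X : ℝ) * P.L) := by unfold Z; rw [hG]
  -- `x = (7/2) n² (κn) Bexp N² 2^lev ≥ 1`, so `log(1+x) ≤ log 2 + log x`
  set x : ℝ := 7 / 2 * (n : ℝ) ^ 2 * (((2 ^ (n - 1) : ℕ) : ℝ) * n) * P.Bexp * P.N ^ 2 * 2 ^ lev with hx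
  have hx1 : 1 ≤ x := by
    rw [hx]
    have h1 : (1 : ℝ) ≤ 7 / 2 * (n : ℝ) ^ 2 := by nlinarith
    have h2 : (1 : ℝ) ≤ P.N ^ 2 := by nlinarith [hN.2.1]
    calc (1 : ℝ) = 1 * 1 * 1 * 1 * 1 := by ring
      _ ≤ 7 / 2 * (n : ℝ) ^ 2 * (((2 ^ (n - 1) : ℕ) : ℝ) * n) * P.Bexp * P.N ^ 2 * 2 ^ lev := by gcongr
  have hx0 : 0 < x := by linarith
  have q1 : (0 : ℝ) < 7 / 2 * (n : ℝ) ^ 2 := mul_pos (by norm_num) (pow_pos hn0 2)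
  have q2 : (0 : ℝ) < ((2 ^ (n - 1) : ℕ) : ℝ) * n := by linarith
  have q3 : (0 : ℝ) < P.Bexp := by linarith
  have q4 : (0 : ℝ) < P.N ^ 2 := pow_pos hN.1 2
  have q5 : (0 : ℝ) < 2 ^ lev := by positivity
  have hlogx : Real.log x = Real.log (7 / 2) + 2 * Real.log n + Real.log (((2 ^ (n - 1) : ℕ) : ℝ) * n) + (P.W - 1) +
      2 * Real.log P.N + lev * Real.log 2 := by
    rw [hx, Real.log_mul (mul_pos (mul_pos (mul_pos q1 q2) q3) q4).ne' q5.ne', Real.log_mul (mul_pos (mul_pos q1 q2) q3).ne' q4.ne',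
      Real.log_mul (mul_pos q1 q2).ne' q3.ne', Real.log_mul q1.ne' q2.ne', Real.log_mul (by norm_num) (pow_pos hn0 2).ne',
      Real.log_pow, Real.log_pow, Real.log_pow, hBlog]
    push_cast; ring
  have hlog1x : Real.log (1 + x) ≤ Real.log 2 + Real.log x := by
    rw [← Real.log_mul two_ne_zero hx0.ne']; exact Real.log_le_log (by linarith) (by linarith)
  have h72 : Real.log (7 / 2 : ℝ) ≤ 7 / 2 - 1 := Real.log_le_sub_one_of_pos (by norm_num)
  have hlogn : Real.log (n : ℝ) ≤ n - 1 := Real.log_le_sub_one_of_pos hn0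
  have h5 : (lev : ℝ) * Real.log 2 ≤ 10 * n + 29 + Real.log P.N := by
    have h' : (lev : ℝ) ≤ P.Sd := by exact_mod_cast hlev
    have := mul_le_mul_of_nonneg_right h' hl2p.le
    linarith
  -- `log(2·CRK) ≤ 2 log 2 + log x ≤ 13.7 n + 32 + 4·WN`
  have hlogC : Real.log (2 * P.CRK (2 ^ (n - 1)) lev) ≤ 137 / 10 * n + 32 + 4 * P.WN := by
    linarith only [hC, hlog1x, hlogx, h72, hlogn, hlogκ, h5, hl2, hWN.2.1, hWN.2.2.1]
  have hlogC0 : 0 ≤ Real.log (2 * P.CRK (2 ^ (n - 1)) lev) := Real.log_nonneg (by linarith only [hC1])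
  have h1 : (P.T lev : ℝ) * Real.log (2 * P.CRK (2 ^ (n - 1)) lev) ≤ 8 * P.L * (137 / 10 * n + 32 + 4 * P.WN) :=
    mul_le_mul hT8 hlogC hlogC0 (by positivity)
  -- `8L(13.7n + 32) ≤ XL·(…)`, `32 L·WN ≤ 4 XL`
  have h2 : (P.L : ℝ) * P.WN ≤ (P.X : ℝ) * P.L / 8 := by
    rw [le_div_iff₀ (by norm_num)]
    have hZW' : ((n : ℝ) + 1) * ((P.L : ℝ) * P.WN * 8) ≤ ((n : ℝ) + 1) * ((P.X : ℝ) * P.L) := by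
      rw [hZ] at hZW; linarith only [hZW]
    have hpos : (0 : ℝ) < ((n : ℝ) + 1) := by positivity
    exact le_of_mul_le_mul_left hZW' hpos
  have h3 : (P.L : ℝ) * ((n : ℝ) + 1) ≤ (P.X : ℝ) * P.L / 64 := by
    rw [le_div_iff₀ (by norm_num)]
    have := mul_le_mul_of_nonneg_right hX hL0.le
    linarith only [this]
  have h4 : (P.L : ℝ) ≤ (P.X : ℝ) * P.L / 128 := by
    rw [le_div_iff₀ (by norm_num)]
    have := mul_le_mul_of_nonneg_right hX128 hL0.le
    linarith only [this]
  have e1 : 8 * (P.L : ℝ) * (137 / 10 * n + 32 + 4 * P.WN) = 548 / 5 * ((P.L : ℝ) * ((n : ℝ) + 1)) + 732 / 5 * (P.L : ℝ) + 32 * ((P.L : ℝ) * P.WN) := by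
    ring
  linarith only [h1, e1, h2, h3, h4, hL0, hX128]

/-! ### The threshold bracket -/

/-- **the `2ⁿ`-threshold bracket of the half step** (jets radius, Feldman block, unit count, start print, Δ-weight, Hasse weight,
slab, weights), for `Tf (lev+1) 0 ≤ σ(n+1)L`: `2ⁿ·(…) ≤ 2ⁿ·RHS(σ) + (51/100)·n·2ⁿXL + 2ⁿXL/2^16`.
[cite: Nesterenko2003, §4.3 (4.48)–(4.49); shape only] -/
theorem jet_le (hn2 : 2 ≤ n) {lev : ℕ} (hlev : lev < P.Sd) {σ : ℝ} (hσ0 : 0 ≤ σ)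
    (hT' : (P.Tf (lev + 1) 0 : ℝ) ≤ σ * (((n : ℝ) + 1) * P.L))
    (s : ℤ) (a : ℕ) (hsabs : |s| ≤ 2 * (P.Nh (lev + 1) : ℤ) - 1) (ha : a < P.Tf (lev + 1) 0) :
    (2 : ℝ) ^ n * (Real.log 4 + (23 / 20 * a * P.H + (|(s : ℝ)| * ∑ j, ((P.LνRR lev j : ℝ) / P.N) * P.A j + n * P.SAR + 2 * P.SAR)) +
        (Real.log 2 + P.cUR + P.cPRK (2 ^ (n - 1)) + Real.log (DΔC (P.YRK (2 ^ (n - 1)) lev) (P.Tf (lev + 1) 0)) +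
          (Real.log (WC P.H (P.Sd - (lev + 1) + 1) P.L₀ (P.Tf (lev + 1) 0) (P.Nh (lev + 1))) + (P.γb lev + P.wl lev) * P.Nh (lev + 1) +
            P.AθsumR / 2)) + 2 * P.cHR) ≤
      2 ^ n * (23 / 20 * (σ * (((n : ℝ) + 1) * ((P.X : ℝ) * P.L)) / 8) + (2 + 1 / 2 ^ 6) * n * ((P.X : ℝ) * P.L) + 11 / 2 * (P.Z / 3072) +
        (P.Z / 392 + P.Z / 2 ^ 29) + 51 / 25 * P.Z +
        (σ * P.Z / 64 + σ * P.Z / 64 + 17 / 10 * (σ * (((n : ℝ) + 1) * ((P.X : ℝ) * P.L)) / 64) + 3 * (σ * (((n : ℝ) + 1) * ((P.X : ℝ) * P.L)) / 64) +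
          σ * ((P.X : ℝ) * P.L) / 64) +
        (σ * (10 * (((n : ℝ) + 1) * ((P.X : ℝ) * P.L)) + 19 * ((P.X : ℝ) * P.L)) / 64 + σ * P.Z / 64 + 22 / 100 * P.Z) + (P.X : ℝ) * P.L / 2 ^ 26) +
      (51 / 100 * n * (2 ^ n * ((P.X : ℝ) * P.L)) + 2 ^ n * ((P.X : ℝ) * P.L) / 2 ^ 16) := by
  have hκ : 1 ≤ 2 ^ (n - 1) := Nat.one_le_two_pow
  have hn : (2 : ℝ) ≤ n := by exact_mod_cast hn2
  have h2n0 : (0 : ℝ) ≤ 2 ^ n := by positivity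
  have hT'0 : (0 : ℝ) ≤ P.Tf (lev + 1) 0 := Nat.cast_nonneg _
  obtain ⟨-, tn, t1, tW, tN, tS, tH⟩ := P.Tcost_le hT'0 hσ0 hT'
  obtain ⟨hρNh, -, -, -, -, hNh0⟩ := P.rho_bounds lev
  obtain ⟨-, hγ2, -, -, -⟩ := P.gamma_le lev
  obtain ⟨hcU, -⟩ := P.cUR_le' hn2
  have hcP := P.cPRK_two_pow_le hn2
  have hD := P.logDΔCK_le (2 ^ (n - 1)) hκ lev (lev + 1) 0
  obtain ⟨hlogκ, -⟩ := log_kappa_le P.hn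
  have hlog3n : Real.log ((n : ℝ) + 2) ≤ (n : ℝ) + 1 := by
    have := Real.log_le_sub_one_of_pos (by positivity : (0 : ℝ) < n + 2); linarith only [this]
  have hD' : Real.log (DΔC (P.YRK (2 ^ (n - 1)) lev) (P.Tf (lev + 1) 0)) ≤
      σ * P.Z / 64 + σ * P.Z / 64 + 17 / 10 * (σ * (((n : ℝ) + 1) * ((P.X : ℝ) * P.L)) / 64) + 3 * (σ * (((n : ℝ) + 1) * ((P.X : ℝ) * P.L)) / 64) +
        σ * ((P.X : ℝ) * P.L) / 64 := by
    have k1 : (P.Tf (lev + 1) 0 : ℝ) * Real.log (((2 ^ (n - 1) : ℕ) : ℝ) * n) ≤ (P.Tf (lev + 1) 0 : ℝ) * (17 / 10 * n) :=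
      mul_le_mul_of_nonneg_left hlogκ hT'0
    have k2 : (P.Tf (lev + 1) 0 : ℝ) * (17 / 10 * (n : ℝ)) ≤ 17 / 10 * ((P.Tf (lev + 1) 0 : ℝ) * ((n : ℝ) + 1)) := by
      have e2 : 17 / 10 * ((P.Tf (lev + 1) 0 : ℝ) * ((n : ℝ) + 1)) = (P.Tf (lev + 1) 0 : ℝ) * (17 / 10 * (n : ℝ)) + 17 / 10 * (P.Tf (lev + 1) 0 : ℝ) := by ring
      rw [e2]; linarith only [hT'0]
    have k3 : (P.Tf (lev + 1) 0 : ℝ) * Real.log ((n : ℝ) + 2) ≤ (P.Tf (lev + 1) 0 : ℝ) * ((n : ℝ) + 1) := mul_le_mul_of_nonneg_left hlog3n hT'0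
    have e : (P.Tf (lev + 1) 0 : ℝ) * (P.WN + Real.log P.N + Real.log (((2 ^ (n - 1) : ℕ) : ℝ) * n) + 3 * Real.log ((n : ℝ) + 2) + 1) =
        (P.Tf (lev + 1) 0 : ℝ) * P.WN + (P.Tf (lev + 1) 0 : ℝ) * Real.log P.N + (P.Tf (lev + 1) 0 : ℝ) * Real.log (((2 ^ (n - 1) : ℕ) : ℝ) * n) +
          3 * ((P.Tf (lev + 1) 0 : ℝ) * Real.log ((n : ℝ) + 2)) + (P.Tf (lev + 1) 0 : ℝ) := by ring
    linarith only [hD, e, k1, k2, k3, tW, tN, tn, t1]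
  have hWh := P.logWC_half_le hn2 hlev (P.Tf (lev + 1) 0) hNh0 hρNh
  have hdeb := P.debris_le hn2
  obtain ⟨hsS, -, -⟩ := P.sAbs_sum_le lev hsabs
  obtain ⟨-, hnS, hS, hAθ, hcH, -, -⟩ := P.nsq_Omega_le
  obtain ⟨hl2, -, hl4, -⟩ := log_consts
  have ha' : (a : ℝ) ≤ P.Tf (lev + 1) 0 := by exact_mod_cast ha.le
  have haH : 23 / 20 * (a : ℝ) * P.H ≤ 23 / 20 * (σ * (((n : ℝ) + 1) * ((P.X : ℝ) * P.L)) / 8) := by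
    have := mul_le_mul_of_nonneg_right ha' (Nat.cast_nonneg P.H)
    linarith only [this, tH]
  have hJ : Real.log 4 + (23 / 20 * a * P.H + (|(s : ℝ)| * ∑ j, ((P.LνRR lev j : ℝ) / P.N) * P.A j + n * P.SAR + 2 * P.SAR)) +
        (Real.log 2 + P.cUR + P.cPRK (2 ^ (n - 1)) + Real.log (DΔC (P.YRK (2 ^ (n - 1)) lev) (P.Tf (lev + 1) 0)) +
          (Real.log (WC P.H (P.Sd - (lev + 1) + 1) P.L₀ (P.Tf (lev + 1) 0) (P.Nh (lev + 1))) + (P.γb lev + P.wl lev) * P.Nh (lev + 1) +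
            P.AθsumR / 2)) + 2 * P.cHR ≤
      (23 / 20 * (σ * (((n : ℝ) + 1) * ((P.X : ℝ) * P.L)) / 8) + (2 + 1 / 2 ^ 6) * n * ((P.X : ℝ) * P.L) + 11 / 2 * (P.Z / 3072) +
        (P.Z / 392 + P.Z / 2 ^ 29) + 51 / 25 * P.Z +
        (σ * P.Z / 64 + σ * P.Z / 64 + 17 / 10 * (σ * (((n : ℝ) + 1) * ((P.X : ℝ) * P.L)) / 64) + 3 * (σ * (((n : ℝ) + 1) * ((P.X : ℝ) * P.L)) / 64) +
          σ * ((P.X : ℝ) * P.L) / 64) +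
        (σ * (10 * (((n : ℝ) + 1) * ((P.X : ℝ) * P.L)) + 19 * ((P.X : ℝ) * P.L)) / 64 + σ * P.Z / 64 + 22 / 100 * P.Z) + (P.X : ℝ) * P.L / 2 ^ 26) +
        (P.γb lev + P.wl lev) * P.Nh (lev + 1) := by
    linarith only [haH, hsS, hnS, hS, hAθ, hcH, hcU, hcP, hD', hWh, tS, hdeb, hl2, hl4]
  have hJ2 := mul_le_mul_of_nonneg_left hJ h2n0
  linarith only [hJ2, hγ2]

end ArchG3Rec

end Summit.ABC.StewartYu

end
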